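import Summits.Ventures.PercRepro.PuncturedLYMTwoCoHypPosLayer
import Summits.Ventures.PercRepro.PuncturedLYMTwoCoHypGenCorner

/-!
# PercRepro — TWO CO-HYPERPLANES OF ANY INTERSECTION, PART 6: POSITIVITY OF THE EQUAL-SPLIT FLOW (p10, gen 35)

Arithmetic only.  Every weight of the flow of parts 3–5 is nonnegative on the profiles of `P` when
`s + 2 ≤ m₁, m₂ ≤ j`, `j + 2 ≤ m₁ + m₂ − s` and `2j + 1 ≤ n`:
* `typeI_A_nonneg` — the `+A` weight of a type-I row: `m₁·(n − j)·wA = (j + 1)(1 − δ₁ − δ₂) − s·(f²_{b+s} + g²_{b+s−1})`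
  and `s·g²_{b+s−1} ≤ (j + 1 − b − s)·f²_{b+s} − (j + 1)·δ₂` (the column identity of `C₂`), so
  `m₁·(n − j)·wA ≥ (j + 1)·(1 − δ₁ − f²_{b+s}) ≥ 0`;
* `typeII_D_nonneg` — the `+D` weight of a type-II row: `m₁·(n − j)·wD = (j + 1)(1 − δ₁ − δ₂) + #A·(f² + g²) ≥ 0`;
* `gCornerR_nonneg` — the corner `+R` weight: the two forced edges carry at most `(j + 1)/((n − j)·m_i)` each;
The `+R` weights of the corrected rows and the assembly `w3_nonneg` are part 6b (PuncturedLYMTwoCoHypGenPosR).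
Nothing here asserts (SP).
-/

namespace PercRepro.PuncturedLYM

open Finset

/-- `δ ≤ 1/4` for `2 ≤ m`. -/
theorem coDel_le_quarter {n j m : ℕ} (hm : 2 ≤ m) (hmj : m ≤ j) (hn : 2 * j + 1 ≤ n) : coDel n j m ≤ 1 / 4 := by
  have h := coDel_mul_two_pow_le hmj hn
  have h4 : (4 : ℚ) ≤ 2 ^ m := by
    calc (4 : ℚ) = 2 ^ 2 := by norm_num
      _ ≤ 2 ^ m := pow_le_pow_right₀ (by norm_num) hm
  have := coDel_nonneg n j m
  nlinarith

/-- `δ ≤ 1/8` for `3 ≤ m`. -/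
theorem coDel_le_eighth {n j m : ℕ} (hm : 3 ≤ m) (hmj : m ≤ j) (hn : 2 * j + 1 ≤ n) : coDel n j m ≤ 1 / 8 := by
  have h := coDel_mul_two_pow_le hmj hn
  have h8 : (8 : ℚ) ≤ 2 ^ m := by
    calc (8 : ℚ) = 2 ^ 3 := by norm_num
      _ ≤ 2 ^ m := pow_le_pow_right₀ (by norm_num) hm
  have := coDel_nonneg n j m
  nlinarith

/-- `m₁·(n − j)·(supA (m₁ − 1) (b + s) − gErr b/m₁) = (j + 1)(1 − δ₁ − δ₂) − s·(f²_{b+s} + g²_{b+s−1})`. -/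
theorem typeI_A_eq {n j m₁ m₂ s b : ℕ} (hm₁ : 1 ≤ m₁) (hm₁j : m₁ ≤ j) (hn : 2 * j + 1 ≤ n) (hs₁ : s ≤ m₁) :
    (m₁ : ℚ) * (((n - j : ℕ) : ℚ) * (supA n j m₁ m₂ (m₁ - 1) (b + s) - gErr n j m₁ m₂ s b / (m₁ : ℚ))) =
      ((j : ℚ) + 1) * (1 - coDel n j m₁ - coDel n j m₂) -
        (s : ℚ) * (coF n j m₂ (b + s) + coG n j m₂ (b + s - 1)) := by
  have hA := supA_eq (n := n) (j := j) (m₁ := m₁) (m₂ := m₂) (a := m₁ - 1) (b := b + s) hn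
  have herr := gErr_eq (m₂ := m₂) (b := b) hm₁ hm₁j hn hs₁
  have ht := coF_top (m := m₁) hm₁ hm₁j hn
  have hm : (m₁ : ℚ) ≠ 0 := by
    have : (1 : ℚ) ≤ m₁ := by exact_mod_cast hm₁
    linarith
  have hAs : ((m₁ - s : ℕ) : ℚ) = (m₁ : ℚ) - s := by rw [Nat.cast_sub hs₁]
  rw [hAs] at herr
  have e : (m₁ : ℚ) * (((n - j : ℕ) : ℚ) * (supA n j m₁ m₂ (m₁ - 1) (b + s) - gErr n j m₁ m₂ s b / (m₁ : ℚ))) =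
      (m₁ : ℚ) * (((n - j : ℕ) : ℚ) * supA n j m₁ m₂ (m₁ - 1) (b + s)) - ((n - j : ℕ) : ℚ) * gErr n j m₁ m₂ s b := by
    field_simp
  rw [e, hA, herr]
  linear_combination ht

/-- **The `+A` weight of a type-I row is nonnegative** (`b + s < m₂`, `2 ≤ m₁, m₂`). -/
theorem typeI_A_nonneg {n j m₁ m₂ s b : ℕ} (hm₁ : 2 ≤ m₁) (hm₁j : m₁ ≤ j) (hm₂ : 2 ≤ m₂) (hm₂j : m₂ ≤ j)
    (hn : 2 * j + 1 ≤ n) (hs₁ : s ≤ m₁) (hbs : b + s < m₂) :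
    0 ≤ supA n j m₁ m₂ (m₁ - 1) (b + s) - gErr n j m₁ m₂ s b / (m₁ : ℚ) := by
  have hr : (0 : ℚ) < ((n - j : ℕ) : ℚ) := by
    have : 1 ≤ n - j := by omega
    exact_mod_cast this
  have hm : (0 : ℚ) < (m₁ : ℚ) := by exact_mod_cast (show 0 < m₁ by omega)
  have heq := typeI_A_eq (m₂ := m₂) (b := b) (by omega) hm₁j hn hs₁
  have hcol := coF_col_all (m := m₂) (c' := b + s) (by omega) hm₂j hn hbs
  have hδ1 := coDel_le_quarter hm₁ hm₁j hn
  have hδ2 := coDel_nonneg n j m₂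
  have hf := coF_le_half (m := m₂) (c := b + s) hm₂ hm₂j hn hbs
  have hf0 := coF_nonneg (m := m₂) (c := b + s) (by omega) hm₂j hn hbs.le
  have hg0 : 0 ≤ coG n j m₂ (b + s - 1) := coG_nonneg (by omega) hm₂j hn (by omega)
  have hj : (0 : ℚ) ≤ (j : ℚ) + 1 := by positivity
  have hsq : (0 : ℚ) ≤ s := by positivity
  have hbq : (0 : ℚ) ≤ b := by positivity
  have hbs' : ((b + s : ℕ) : ℚ) = (b : ℚ) + s := by push_cast; ring
  rw [hbs'] at hcol
  -- `s·g ≤ (b + s)·g = (j + 1 − b − s)·f − (j + 1)·δ₂`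
  have hsg : (s : ℚ) * coG n j m₂ (b + s - 1) ≤ ((j : ℚ) + 1 - b - s) * coF n j m₂ (b + s) - ((j : ℚ) + 1) * coDel n j m₂ := by
    nlinarith
  have hmain : 0 ≤ ((j : ℚ) + 1) * (1 - coDel n j m₁ - coDel n j m₂) -
      (s : ℚ) * (coF n j m₂ (b + s) + coG n j m₂ (b + s - 1)) := by
    nlinarith
  rw [← heq] at hmain
  have := nonneg_of_mul_nonneg_right hmain hm
  by_contra hneg
  have : ((n - j : ℕ) : ℚ) * (supA n j m₁ m₂ (m₁ - 1) (b + s) - gErr n j m₁ m₂ s b / (m₁ : ℚ)) < 0 :=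
    mul_neg_of_pos_of_neg hr (not_le.1 hneg)
  linarith

/-- **The `+D` weight of a type-II row is nonnegative** (`b + s ≤ m₂`, `2 ≤ m₁, m₂`). -/
theorem typeII_D_nonneg {n j m₁ m₂ s b : ℕ} (hm₁ : 2 ≤ m₁) (hm₁j : m₁ ≤ j) (hm₂ : 2 ≤ m₂) (hm₂j : m₂ ≤ j)
    (hn : 2 * j + 1 ≤ n) (hs₁ : s ≤ m₁) (hbs : b + s ≤ m₂) :
    0 ≤ supD n j m₁ m₂ (m₁ - 1) (b + s - 1) - gErr n j m₁ m₂ s b / (m₁ : ℚ) := by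
  have hr : (0 : ℚ) < ((n - j : ℕ) : ℚ) := by
    have : 1 ≤ n - j := by omega
    exact_mod_cast this
  have hm : (0 : ℚ) < (m₁ : ℚ) := by exact_mod_cast (show 0 < m₁ by omega)
  have hD := supD_eq (n := n) (j := j) (m₁ := m₁) (m₂ := m₂) (c₁ := m₁ - 1) (c₂ := b + s - 1) hn
  have herr := gErr_eq (m₂ := m₂) (b := b) (by omega) hm₁j hn hs₁
  have ht := coF_top (m := m₁) (by omega) hm₁j hn
  have hAs : ((m₁ - s : ℕ) : ℚ) = (m₁ : ℚ) - s := by rw [Nat.cast_sub hs₁]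
  have hδ1 := coDel_le_quarter hm₁ hm₁j hn
  have hδ2 := coDel_le_quarter hm₂ hm₂j hn
  have hf0 := coF_nonneg (m := m₂) (c := b + s) (by omega) hm₂j hn hbs
  have hg0 : 0 ≤ coG n j m₂ (b + s - 1) := coG_nonneg (by omega) hm₂j hn (by omega)
  have hAq : (0 : ℚ) ≤ (m₁ : ℚ) - s := by
    have : (s : ℚ) ≤ m₁ := by exact_mod_cast hs₁
    linarith
  have hj : (0 : ℚ) ≤ (j : ℚ) + 1 := by positivity
  -- `m₁·(n − j)·wD = (j + 1)(1 − δ₁ − δ₂) + (m₁ − s)·(f + g)`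
  have heq : (m₁ : ℚ) * (((n - j : ℕ) : ℚ) * (supD n j m₁ m₂ (m₁ - 1) (b + s - 1) - gErr n j m₁ m₂ s b / (m₁ : ℚ))) =
      ((j : ℚ) + 1) * (1 - coDel n j m₁ - coDel n j m₂) +
        ((m₁ : ℚ) - s) * (coF n j m₂ (b + s) + coG n j m₂ (b + s - 1)) := by
    rw [hAs] at herr
    have hm' : (m₁ : ℚ) ≠ 0 := hm.ne'
    have e : (m₁ : ℚ) * (((n - j : ℕ) : ℚ) * (supD n j m₁ m₂ (m₁ - 1) (b + s - 1) - gErr n j m₁ m₂ s b / (m₁ : ℚ))) =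
        (m₁ : ℚ) * (((n - j : ℕ) : ℚ) * supD n j m₁ m₂ (m₁ - 1) (b + s - 1)) - ((n - j : ℕ) : ℚ) * gErr n j m₁ m₂ s b := by
      field_simp
    rw [e, hD, herr]
    linear_combination ht
  have hmain : 0 ≤ ((j : ℚ) + 1) * (1 - coDel n j m₁ - coDel n j m₂) +
      ((m₁ : ℚ) - s) * (coF n j m₂ (b + s) + coG n j m₂ (b + s - 1)) := by
    have : 0 ≤ ((j : ℚ) + 1) * (1 - coDel n j m₁ - coDel n j m₂) := by
      apply mul_nonneg hj
      linarith
    nlinarith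
  rw [← heq] at hmain
  have := nonneg_of_mul_nonneg_right hmain hm
  by_contra hneg
  have : ((n - j : ℕ) : ℚ) * (supD n j m₁ m₂ (m₁ - 1) (b + s - 1) - gErr n j m₁ m₂ s b / (m₁ : ℚ)) < 0 :=
    mul_neg_of_pos_of_neg hr (not_le.1 hneg)
  linarith

/-- The forced `+A` weight of the corner row is at most `(j + 1)/((n − j)·m₁)`. -/
theorem typeI_A_le {n j m₁ m₂ s b : ℕ} (hm₁ : 1 ≤ m₁) (hm₁j : m₁ ≤ j) (hm₂ : 1 ≤ m₂) (hm₂j : m₂ ≤ j)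
    (hn : 2 * j + 1 ≤ n) (hs₁ : s ≤ m₁) (hbs : b + s ≤ m₂) (hbs1 : b + s - 1 < m₂) :
    ((n - j : ℕ) : ℚ) * (supA n j m₁ m₂ (m₁ - 1) (b + s) - gErr n j m₁ m₂ s b / (m₁ : ℚ)) ≤ ((j : ℚ) + 1) / (m₁ : ℚ) := by
  have hm : (0 : ℚ) < (m₁ : ℚ) := by exact_mod_cast hm₁
  have heq := typeI_A_eq (m₂ := m₂) (b := b) hm₁ hm₁j hn hs₁
  have hδ1 := coDel_nonneg n j m₁
  have hδ2 := coDel_nonneg n j m₂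
  have hf0 := coF_nonneg (m := m₂) (c := b + s) hm₂ hm₂j hn hbs
  have hg0 : 0 ≤ coG n j m₂ (b + s - 1) := coG_nonneg hm₂ hm₂j hn hbs1
  have hsq : (0 : ℚ) ≤ s := by positivity
  have hj : (0 : ℚ) ≤ (j : ℚ) + 1 := by positivity
  rw [le_div_iff₀ hm, mul_comm, heq]
  nlinarith

/-- **The corner `+R` weight is nonnegative**: `wA_c + wB_c ≤ (j + 1)/(n − j)·(1/m₁ + 1/m₂) ≤ 1`. -/
theorem gCornerR_nonneg {n j m₁ m₂ s : ℕ} (hm₁ : 2 ≤ m₁) (hm₁j : m₁ ≤ j) (hm₂ : 2 ≤ m₂) (hm₂j : m₂ ≤ j)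
    (hn : 2 * j + 1 ≤ n) (hs₁ : s + 1 ≤ m₁) (hs₂ : s + 1 ≤ m₂) : 0 ≤ gCornerR n j m₁ m₂ s := by
  have hr : (0 : ℚ) < ((n - j : ℕ) : ℚ) := by
    have : 1 ≤ n - j := by omega
    exact_mod_cast this
  have hA := typeI_A_le (n := n) (j := j) (m₁ := m₁) (m₂ := m₂) (s := s) (b := m₂ - s - 1) (by omega) hm₁j (by omega)
    hm₂j hn (by omega) (by omega) (by omega)
  have hB := typeI_A_le (n := n) (j := j) (m₁ := m₂) (m₂ := m₁) (s := s) (b := m₁ - s - 1) (by omega) hm₂j (by omega)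
    hm₁j hn (by omega) (by omega) (by omega)
  have e1 : m₂ - s - 1 + s = m₂ - 1 := by omega
  have e2 : m₁ - s - 1 + s = m₁ - 1 := by omega
  rw [e1] at hA
  rw [e2, supA_symm n j m₂ m₁ (m₂ - 1) (m₁ - 1)] at hB
  have hm₁q : (2 : ℚ) ≤ m₁ := by exact_mod_cast hm₁
  have hm₂q : (2 : ℚ) ≤ m₂ := by exact_mod_cast hm₂
  have hrj : (j : ℚ) + 1 ≤ ((n - j : ℕ) : ℚ) := by exact_mod_cast (show j + 1 ≤ n - j by omega)
  have hj : (0 : ℚ) ≤ (j : ℚ) + 1 := by positivity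
  -- `(j + 1)/m₁ + (j + 1)/m₂ ≤ j + 1 ≤ n − j`
  have h1 : ((j : ℚ) + 1) / (m₁ : ℚ) ≤ ((j : ℚ) + 1) / 2 := by
    apply div_le_div_of_nonneg_left hj (by norm_num) hm₁q
  have h2 : ((j : ℚ) + 1) / (m₂ : ℚ) ≤ ((j : ℚ) + 1) / 2 := by
    apply div_le_div_of_nonneg_left hj (by norm_num) hm₂q
  have hsum : ((n - j : ℕ) : ℚ) * (supA n j m₁ m₂ (m₁ - 1) (m₂ - 1) - gErr n j m₁ m₂ s (m₂ - s - 1) / (m₁ : ℚ) +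
      (supB n j m₁ m₂ (m₁ - 1) (m₂ - 1) - gErr n j m₂ m₁ s (m₁ - s - 1) / (m₂ : ℚ))) ≤ ((n - j : ℕ) : ℚ) * 1 := by
    rw [mul_add, mul_one]
    linarith
  have hle := le_of_mul_le_mul_left hsum hr
  unfold gCornerR
  apply div_nonneg _ (by positivity)
  linarith

end PercRepro.PuncturedLYM
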